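import Summits.Schanuel.Schanuel.Theorems.ZilberEacFibreCurveGrowthTwo
import Summits.Schanuel.Schanuel.Theorems.ZilberEacParamCurveRoot
import HarnessLib

/-!
# Polynomially parametrised base curves, XXX: growth of `Re g₁` at the SUB-LEADING order along
# points `t_j = ρ_j ω + τ + o(1)` when the leading phase `Re(lc(g₁) ω^n)` vanishes

HONEST FRAMING.  Cell `pub-schanuel` (Zilber's Exponential-Algebraic Closedness, case ladder;
host summit Schanuel), seat 2, gen 20.  The analytic half of the vanishing-phase theorem
(file XXXI): let `G ∈ ℂ[t]` have degree `n ≥ 2`, leading coefficient `b` and next coefficient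
`b' = G_{n-1}`; let `ω, τ ∈ ℂ` with `Re(b ω^n) = 0` and
`c = Re((b' + n b τ) ω^{n-1}) ≠ 0`; let `ρ_j → +∞` be real and `t_j ∈ ℂ` with
`t_j - ρ_j ω → τ`.  Then `|Re G(t_j)| / log(2 + ‖G(t_j)‖) → ∞`
(`tendsto_growth_eval_of_subleading`): writing `t_j = X + Y` with `X = ρ_j ω`, `Y → τ`,
`G(t_j) = b X^n + ρ_j^{n-1} (b' + n b Y) ω^{n-1} + O(ρ_j^{n-2})` (second-order Taylor,
`norm_pow_sub_pow_sub_mul_le`), the first term is purely imaginary, the second has real part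
`(c + o(1)) ρ_j^{n-1}`, so `|Re G(t_j)| ≥ (|c|/4) ρ_j^{n-1}` eventually while
`‖G(t_j)‖ = O(ρ_j^n)`.  Used with the located zeros of file XXIX.  Mantova–Masser's question is
OPEN in general (PLMS 2024 §1 p. 5); NOT Schanuel's conjecture (neither used nor implied;
EAC ⇏ SC); `EC(3,2)` stays OPEN.
-/

noncomputable section

open Filter Topology Metric Set Complex Polynomial
open Literature.ModelTheory.Zilber
open Literature.Geometry.Symplectic.RotationBranch (norm_pow_sub_pow_le)

set_option linter.dupNamespace false

namespace Summit.Schanuel.Schanuel.Theorems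

/-- `2 + C x^{m+2} ≤ (2 + C x)^{m+2}` for `C ≥ 1`, `x ≥ 0`. -/
theorem two_add_mul_pow_le_pow {C x : ℝ} (hC : 1 ≤ C) (hx : 0 ≤ x) (m : ℕ) :
    2 + C * x ^ (m + 2) ≤ (2 + C * x) ^ (m + 2) := by
  have hC0 : 0 ≤ C := zero_le_one.trans hC
  have h1 : (2 : ℝ) ≤ 2 ^ (m + 2) := by
    calc (2 : ℝ) = 2 ^ 1 := (pow_one _).symm
      _ ≤ 2 ^ (m + 2) := pow_le_pow_right₀ (by norm_num) (by omega)
  have h2 : C * x ^ (m + 2) ≤ (C * x) ^ (m + 2) := by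
    rw [mul_pow]
    refine mul_le_mul_of_nonneg_right ?_ (pow_nonneg hx _)
    calc C = C ^ 1 := (pow_one _).symm
      _ ≤ C ^ (m + 2) := pow_le_pow_right₀ hC (by omega)
  calc 2 + C * x ^ (m + 2) ≤ 2 ^ (m + 2) + (C * x) ^ (m + 2) := add_le_add h1 h2
    _ ≤ (2 + C * x) ^ (m + 2) := pow_add_pow_le (by norm_num) (by positivity) (by omega)

/-- **Growth at the sub-leading order.**  See the module docstring. (new) -/
theorem tendsto_growth_eval_of_subleading (G : Polynomial ℂ) (hn : 2 ≤ G.natDegree) (ω τ : ℂ)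
    (hre0 : (G.leadingCoeff * ω ^ G.natDegree).re = 0)
    (hc : ((G.coeff (G.natDegree - 1) + G.natDegree * G.leadingCoeff * τ) *
      ω ^ (G.natDegree - 1)).re ≠ 0)
    {ρ : ℕ → ℝ} (hρ : Tendsto ρ atTop atTop) {t : ℕ → ℂ}
    (ht : Tendsto (fun j => t j - (ρ j : ℂ) * ω) atTop (𝓝 τ)) :
    Tendsto (fun j => |(G.eval (t j)).re| / Real.log (2 + ‖G.eval (t j)‖)) atTop atTop := by
  obtain ⟨m, hm⟩ : ∃ m : ℕ, G.natDegree = m + 2 := ⟨G.natDegree - 2, by omega⟩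
  have hm1 : G.natDegree - 1 = m + 1 := by omega
  rw [hm1, hm] at hc
  rw [hm] at hre0
  -- names
  obtain ⟨b, hb_def⟩ : ∃ b : ℂ, b = G.leadingCoeff := ⟨_, rfl⟩
  obtain ⟨b', hb'_def⟩ : ∃ b' : ℂ, b' = G.coeff (m + 1) := ⟨_, rfl⟩
  rw [← hb_def] at hre0 hc
  rw [← hb'_def] at hc
  obtain ⟨ℓ₂, hℓ₂_def⟩ : ∃ ℓ₂ : Polynomial ℂ,
      ℓ₂ = G.eraseLead - Polynomial.C b' * Polynomial.X ^ (m + 1) := ⟨_, rfl⟩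
  have hℓ₂deg : ℓ₂.natDegree ≤ m := by rw [hℓ₂_def, hb'_def]; exact natDegree_sublead_le G hm
  set lin : ℂ → ℝ := fun y => ((b' + ((m + 2 : ℕ) : ℂ) * b * y) * ω ^ (m + 1)).re with hlin_def
  set c : ℝ := lin τ with hc_def
  have hc0 : c ≠ 0 := by rw [hc_def, hlin_def]; exact hc
  have hcpos : 0 < |c| := abs_pos.2 hc0
  set Y : ℕ → ℂ := fun j => t j - (ρ j : ℂ) * ω with hY_def
  have hY : Tendsto Y atTop (𝓝 τ) := ht
  -- the linear coefficient tends to `c`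
  have hlin : Tendsto (fun j => lin (Y j)) atTop (𝓝 c) := by
    have hcont : Continuous lin :=
      Complex.continuous_re.comp ((continuous_const.add (continuous_const.mul continuous_id)).mul
        continuous_const)
    exact (hcont.tendsto τ).comp hY
  have hev1 : ∀ᶠ j in atTop, |c| / 2 ≤ |lin (Y j)| := by
    have h := hlin (Metric.ball_mem_nhds c (half_pos hcpos))
    filter_upwards [h] with j hj
    rw [Set.mem_preimage, Metric.mem_ball, Real.dist_eq] at hj
    have := abs_sub_abs_le_abs_sub c (lin (Y j))
    rw [abs_sub_comm] at hj
    linarith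
  have hev2 : ∀ᶠ j in atTop, ‖Y j‖ ≤ ‖τ‖ + 1 := by
    have h := hY (Metric.ball_mem_nhds τ one_pos)
    filter_upwards [h] with j hj
    rw [Set.mem_preimage, Metric.mem_ball, dist_eq_norm] at hj
    have := norm_le_insert' (Y j) τ
    linarith
  -- constants
  set Y₀ : ℝ := ‖τ‖ + 1 with hY₀
  have hY₀0 : 0 ≤ Y₀ := by positivity
  set L : ℝ := ‖ω‖ + Y₀ + 1 with hL
  have hL1 : 1 ≤ L := by rw [hL]; linarith [norm_nonneg ω]
  have hL0 : 0 ≤ L := zero_le_one.trans hL1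
  set Kj : ℝ := (‖b‖ * ((m + 2 : ℕ) : ℝ) ^ 2 * Y₀ ^ 2 + ‖b'‖ * ((m + 1 : ℕ) : ℝ) * Y₀ +
    coeffNormSum ℓ₂) * L ^ m with hKj
  have hKj0 : 0 ≤ Kj := by have := coeffNormSum_nonneg ℓ₂; positivity
  set C₁ : ℝ := coeffNormSum G * L ^ (m + 2) + 1 with hC₁
  have hC₁1 : 1 ≤ C₁ := by have := coeffNormSum_nonneg G; rw [hC₁]; nlinarith [pow_nonneg hL0 (m + 2)]
  have hC₁pos : 0 < C₁ := by linarith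
  have hev3 : ∀ᶠ j in atTop, 1 ≤ ρ j := hρ.eventually_ge_atTop 1
  have hev4 : ∀ᶠ j in atTop, 4 * Kj / |c| ≤ ρ j := hρ.eventually_ge_atTop _
  -- the pointwise estimate
  have hpt : ∀ j, 1 ≤ ρ j → 4 * Kj / |c| ≤ ρ j → ‖Y j‖ ≤ Y₀ → |c| / 2 ≤ |lin (Y j)| →
      |c| / 4 * ρ j ^ (m + 1) ≤ |(G.eval (t j)).re| ∧ ‖G.eval (t j)‖ ≤ C₁ * ρ j ^ (m + 2) := by
    intro j h1 h4 h2 h3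
    have hρ0 : 0 ≤ ρ j := zero_le_one.trans h1
    set X : ℂ := (ρ j : ℂ) * ω with hX_def
    have htXY : t j = X + Y j := by rw [hY_def, hX_def]; ring
    have hXnorm : ‖X‖ = ρ j * ‖ω‖ := by
      rw [hX_def, norm_mul, Complex.norm_real, Real.norm_eq_abs, abs_of_nonneg hρ0]
    set M : ℝ := ρ j * L with hM_def
    have hM1 : 1 ≤ M := one_le_mul_of_one_le_of_one_le h1 hL1
    have hM0 : 0 ≤ M := zero_le_one.trans hM1
    have hXM : ‖X‖ ≤ M := by
      rw [hXnorm, hM_def]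
      exact mul_le_mul_of_nonneg_left (by rw [hL]; linarith) hρ0
    have htM : ‖t j‖ ≤ M := by
      rw [htXY]
      calc ‖X + Y j‖ ≤ ‖X‖ + ‖Y j‖ := norm_add_le _ _
        _ ≤ ρ j * ‖ω‖ + Y₀ := by rw [hXnorm]; linarith
        _ ≤ ρ j * ‖ω‖ + ρ j * Y₀ + ρ j * 1 := by nlinarith
        _ = M := by rw [hM_def, hL]; ring
    -- Taylor remainders
    have hR₁ := norm_pow_sub_pow_sub_mul_le htM hXM m
    have hR₂ := norm_pow_sub_pow_le htM hXM (m + 1)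
    simp only [Nat.add_sub_cancel] at hR₂
    rw [show t j - X = Y j by rw [htXY]; ring] at hR₁ hR₂
    have hℓ₂n : ‖ℓ₂.eval (t j)‖ ≤ coeffNormSum ℓ₂ * M ^ m :=
      norm_eval_le_of_natDegree_le ℓ₂ hM1 htM hℓ₂deg
    -- the decomposition
    have hdec := eval_eq_lead_add_sublead_add G hm (t j)
    rw [← hb_def, ← hb'_def, ← hℓ₂_def] at hdec
    have hXpow : X ^ (m + 1) = ((ρ j ^ (m + 1) : ℝ) : ℂ) * ω ^ (m + 1) := by
      rw [hX_def, mul_pow]; push_cast; ring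
    have hXpow2 : X ^ (m + 2) = ((ρ j ^ (m + 2) : ℝ) : ℂ) * ω ^ (m + 2) := by
      rw [hX_def, mul_pow]; push_cast; ring
    set junk : ℂ := b * (t j ^ (m + 2) - X ^ (m + 2) - ((m + 2 : ℕ) : ℂ) * X ^ (m + 1) * (t j - X)) +
      b' * (t j ^ (m + 1) - X ^ (m + 1)) + ℓ₂.eval (t j) with hjunk
    rw [show t j - X = Y j by rw [htXY]; ring] at hjunk
    have hsplit : G.eval (t j) = b * ω ^ (m + 2) * ((ρ j ^ (m + 2) : ℝ) : ℂ) +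
        ((b' + ((m + 2 : ℕ) : ℂ) * b * Y j) * ω ^ (m + 1)) * ((ρ j ^ (m + 1) : ℝ) : ℂ) + junk := by
      rw [hdec, hjunk]
      have e1 : b * t j ^ (m + 2) = b * X ^ (m + 2) + ((m + 2 : ℕ) : ℂ) * b * X ^ (m + 1) * Y j +
          b * (t j ^ (m + 2) - X ^ (m + 2) - ((m + 2 : ℕ) : ℂ) * X ^ (m + 1) * Y j) := by ring
      have e2 : b' * t j ^ (m + 1) = b' * X ^ (m + 1) + b' * (t j ^ (m + 1) - X ^ (m + 1)) := by ring
      rw [e1, e2, hXpow, hXpow2]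
      ring
    have hjunk_le : ‖junk‖ ≤ Kj * ρ j ^ m := by
      have hMm : M ^ m = ρ j ^ m * L ^ m := by rw [hM_def, mul_pow]
      have h1' : ‖b * (t j ^ (m + 2) - X ^ (m + 2) - ((m + 2 : ℕ) : ℂ) * X ^ (m + 1) * Y j)‖ ≤
          ‖b‖ * (((m + 2 : ℕ) : ℝ) ^ 2 * M ^ m * Y₀ ^ 2) := by
        rw [norm_mul]
        refine mul_le_mul_of_nonneg_left (hR₁.trans ?_) (norm_nonneg b)
        exact mul_le_mul_of_nonneg_left (pow_le_pow_left₀ (norm_nonneg _) h2 2) (by positivity)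
      have h2' : ‖b' * (t j ^ (m + 1) - X ^ (m + 1))‖ ≤ ‖b'‖ * (((m + 1 : ℕ) : ℝ) * M ^ m * Y₀) := by
        rw [norm_mul]
        refine mul_le_mul_of_nonneg_left (hR₂.trans ?_) (norm_nonneg b')
        exact mul_le_mul_of_nonneg_left h2 (by positivity)
      calc ‖junk‖ ≤ ‖b * (t j ^ (m + 2) - X ^ (m + 2) - ((m + 2 : ℕ) : ℂ) * X ^ (m + 1) * Y j)‖ +
            ‖b' * (t j ^ (m + 1) - X ^ (m + 1))‖ + ‖ℓ₂.eval (t j)‖ := by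
            rw [hjunk]; exact norm_add₃_le
        _ ≤ ‖b‖ * (((m + 2 : ℕ) : ℝ) ^ 2 * M ^ m * Y₀ ^ 2) + ‖b'‖ * (((m + 1 : ℕ) : ℝ) * M ^ m * Y₀) +
            coeffNormSum ℓ₂ * M ^ m := add_le_add (add_le_add h1' h2') hℓ₂n
        _ = Kj * ρ j ^ m := by rw [hKj, hMm]; ring
    -- real parts
    have hre1 : (b * ω ^ (m + 2) * ((ρ j ^ (m + 2) : ℝ) : ℂ)).re = 0 := by
      rw [Complex.re_mul_ofReal, hre0, zero_mul]
    have hre2 : (((b' + ((m + 2 : ℕ) : ℂ) * b * Y j) * ω ^ (m + 1)) * ((ρ j ^ (m + 1) : ℝ) : ℂ)).re =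
        lin (Y j) * ρ j ^ (m + 1) := by
      rw [Complex.re_mul_ofReal]
    have hreG : (G.eval (t j)).re = lin (Y j) * ρ j ^ (m + 1) + junk.re := by
      rw [hsplit, Complex.add_re, Complex.add_re, hre1, hre2, zero_add]
    have hjunkre : |junk.re| ≤ Kj * ρ j ^ m := (Complex.abs_re_le_norm junk).trans hjunk_le
    have hKρ : Kj * ρ j ^ m ≤ |c| / 4 * ρ j ^ (m + 1) := by
      have h4' : Kj ≤ |c| / 4 * ρ j := by
        rw [div_le_iff₀ hcpos] at h4
        linarith
      calc Kj * ρ j ^ m ≤ (|c| / 4 * ρ j) * ρ j ^ m := mul_le_mul_of_nonneg_right h4' (by positivity)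
        _ = |c| / 4 * ρ j ^ (m + 1) := by ring
    refine ⟨?_, ?_⟩
    · rw [hreG]
      have hmain : |c| / 2 * ρ j ^ (m + 1) ≤ |lin (Y j) * ρ j ^ (m + 1)| := by
        rw [abs_mul, abs_of_nonneg (by positivity : (0 : ℝ) ≤ ρ j ^ (m + 1))]
        exact mul_le_mul_of_nonneg_right h3 (by positivity)
      have htri : |lin (Y j) * ρ j ^ (m + 1)| - |junk.re| ≤ |lin (Y j) * ρ j ^ (m + 1) + junk.re| := by
        have := abs_add_le (lin (Y j) * ρ j ^ (m + 1) + junk.re) (-junk.re)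
        rw [add_neg_cancel_right, abs_neg] at this
        linarith
      linarith
    · calc ‖G.eval (t j)‖ ≤ coeffNormSum G * M ^ (m + 2) :=
            norm_eval_le_of_natDegree_le G hM1 htM hm.le
        _ = coeffNormSum G * L ^ (m + 2) * ρ j ^ (m + 2) := by rw [hM_def, mul_pow]; ring
        _ ≤ C₁ * ρ j ^ (m + 2) := by
            refine mul_le_mul_of_nonneg_right ?_ (by positivity)
            rw [hC₁]; linarith
  -- the comparison function
  have hcmp : Tendsto (fun j => |c| / (4 * ((m + 2 : ℕ) : ℝ)) * (ρ j / Real.log (2 + C₁ * ρ j)))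
      atTop atTop :=
    ((gce_tendsto_div_log_affine (by norm_num : (1 : ℝ) < 2) hC₁pos).comp hρ).const_mul_atTop
      (by positivity)
  refine tendsto_atTop_mono' atTop ?_ hcmp
  filter_upwards [hev1, hev2, hev3, hev4] with j h3 h2 h1 h4
  obtain ⟨hlow, hup⟩ := hpt j h1 h4 h2 h3
  have hρ0 : 0 ≤ ρ j := zero_le_one.trans h1
  have hm2pos : (0 : ℝ) < ((m + 2 : ℕ) : ℝ) := by positivity
  have harg : 1 < 2 + C₁ * ρ j := by nlinarith
  have hlogpos : 0 < Real.log (2 + C₁ * ρ j) := Real.log_pos harg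
  have hlogpos' : 0 < Real.log (2 + ‖G.eval (t j)‖) :=
    Real.log_pos (by linarith [norm_nonneg (G.eval (t j))])
  have hlog1 : Real.log (2 + ‖G.eval (t j)‖) ≤ ((m + 2 : ℕ) : ℝ) * Real.log (2 + C₁ * ρ j) := by
    rw [← Real.log_pow]
    refine Real.log_le_log (by linarith [norm_nonneg (G.eval (t j))]) ?_
    calc 2 + ‖G.eval (t j)‖ ≤ 2 + C₁ * ρ j ^ (m + 2) := by linarith
      _ ≤ (2 + C₁ * ρ j) ^ (m + 2) := two_add_mul_pow_le_pow hC₁1 hρ0 m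
  have hρpow : ρ j ≤ ρ j ^ (m + 1) := by
    calc ρ j = ρ j ^ 1 := (pow_one _).symm
      _ ≤ ρ j ^ (m + 1) := pow_le_pow_right₀ h1 (by omega)
  calc |c| / (4 * ((m + 2 : ℕ) : ℝ)) * (ρ j / Real.log (2 + C₁ * ρ j))
      = (|c| / 4 * ρ j) / (((m + 2 : ℕ) : ℝ) * Real.log (2 + C₁ * ρ j)) := by
        field_simp
    _ ≤ (|c| / 4 * ρ j ^ (m + 1)) / (((m + 2 : ℕ) : ℝ) * Real.log (2 + C₁ * ρ j)) :=
        div_le_div_of_nonneg_right (mul_le_mul_of_nonneg_left hρpow (by positivity))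
          (by positivity)
    _ ≤ |(G.eval (t j)).re| / (((m + 2 : ℕ) : ℝ) * Real.log (2 + C₁ * ρ j)) :=
        div_le_div_of_nonneg_right hlow (by positivity)
    _ ≤ |(G.eval (t j)).re| / Real.log (2 + ‖G.eval (t j)‖) :=
        div_le_div_of_nonneg_left (abs_nonneg _) hlogpos' hlog1

end Summit.Schanuel.Schanuel.Theorems
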